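import Summits.HodgeConjecture.HodgeCM.PerL34.S5ConservativeQaut_1

/-! PORT of `HodgeCM/PerL34/S5ConservativeQaut.lean` (HodgeCMPerL run 82) — part 2: continuation of `Summits.HodgeConjecture.HodgeCM.PerL34.S5ConservativeQaut_1` (split at a top-level declaration boundary by port_pkg.py; scope re-opened below; declarations unchanged). -/

-- port_pkg: scope re-opened for this part (file-level context, then the namespace/section stack open at the cut)
set_option autoImplicit false
noncomputable section
open MeasureTheory Matrix Complex
open scoped NNReal ENNReal
open HodgeCM.Prior.Perl34File
open HodgeCM.PerL34.Qaut
namespace HodgeCM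
namespace PerL34
namespace S5ConservativeQaut
attribute [local instance] topD4
attribute [local instance] measD4
attribute [local instance] measCircle
section Bridge
variable {U : Universe} (T : U.ThetaModel)
variable {L : CMField} {ι₁ : L →+* ℂ} (V : HermSpace3 L ι₁) (c : SeesawCtx L)
variable (D : Perl34.TorusData (T.core V c)) (k l : Fin 4)
/-- `pr (r • u_a (e 0) * v (e 1)) ↦ (r/2) • a` under `toHG`. -/
theorem toHG_pr (a : WIdx T V c k l) (r : ℂ) :
    toHG T V c k l (pr μ ρ (σ _) ((r • form _ (ind _ a) 0 (e 0)) * form _ 1 1 (e 1))) = (r / 2) • a.val := by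
  rw [smul_mul_assoc, pr_smul,
    pr_mul ρ_cont ρ_det (σ_cont _) ρ_diag ρ_antidiag (isForm_form _ _ _) (isForm_form _ _ _) (e 0) (e 1),
    map_smul, map_smul, toHG_wedge, smul_smul]
  congr 1
  simp only [e_apply_same, e_apply_ne (show (1 : Fin 2) ≠ 0 by decide), e_apply_ne (show (0 : Fin 2) ≠ 1 by decide),
    mul_one, mul_zero, sub_zero]
  ring

/-- (Ported verbatim from the HodgeCMPerL package; no docstring in the source.) -/
theorem σ_k₀_form (w : B (T.wedgeSet V c k l)) (i : Fin 2) (x : Fin 2 → ℂ) (r : ℂ) :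
    σ _ k₀ (r • form _ w i x) = ξ ^ 1 • (r • form _ w i x) := by
  rw [map_smul, isForm_form, ρ_k₀, Matrix.smul_mulVec, Matrix.one_mulVec, map_smul, pow_one, smul_comm]

/-- **The junk bridge**: every field of pv02-g2's `QautBridge` discharged over the leaf `N19g_core`. -/
def bridge_of_core (hcore : N19g_core T V c D k l) : QautDictionary.QautBridge T V c D k l where
  K := K
  μ := μ
  C := C (T.wedgeSet V c k l)
  σ := σ _
  σ_cont := σ_cont _
  ρ := ρ
  ρ_cont := ρ_cont
  ρ_det := ρ_det
  ρ_diag := ρ_diag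
  ρ_antidiag := ρ_antidiag
  k₀ := k₀
  ξ := ξ
  ξ_ne_zero := ξ_ne_zero
  ξ_pow_ne_one := ξ_pow_ne_one
  ρ_k₀ := ρ_k₀
  toHG := toHG T V c k l
  Forms₁ := fun _ => Set.range fun a : WIdx T V c k l => form _ (ind _ a) 0
  Forms₂ := fun _ => {form _ 1 1}
  isForm₁ := by rintro _ u ⟨a, rfl⟩; exact isForm_form _ _ _
  isForm₂ := by rintro _ v rfl; exact isForm_form _ _ _
  wedge_mem := by
    rintro _ _ u ⟨a, rfl⟩ v rfl
    rw [toHG_wedge]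
    exact a.mem
  P := hcore.choose
  dense := hcore.choose_spec.1
  decomp := by
    intro χ hχ Φ hΦ
    have hy : D.ϑ χ Φ ∈ Submodule.span ℂ (T.wedgeSet V c k l) := hcore.choose_spec.2 χ hχ Φ hΦ
    obtain ⟨cf, hsupp, hsum⟩ := Submodule.mem_span_set.mp hy
    -- enumerate the support
    set n : ℕ := cf.support.card
    let en : Fin n ≃ {g // g ∈ cf.support} := (cf.support.equivFin).symm
    let a : Fin n → WIdx T V c k l := fun i => ⟨(en i).val, hsupp (en i).property⟩
    refine ⟨n, fun i => (2 * cf (a i).val) • form _ (ind _ (a i)) 0 (e 0), fun _ => form _ 1 1 (e 1),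
      fun _ => 1, fun _ => 1, fun i => ⟨le_rfl, σ_k₀_form T V c k l _ _ _ _, fun _ => ?_⟩,
      fun i => ⟨le_rfl, ?_, fun _ => ?_⟩, ?_⟩
    · exact Submodule.smul_mem _ _ (Submodule.subset_span ⟨_, ⟨a i, rfl⟩, e 0, rfl⟩)
    · have h := σ_k₀_form T V c k l (1 : B (T.wedgeSet V c k l)) 1 (e 1) 1
      rwa [one_smul] at h
    · exact Submodule.subset_span ⟨_, rfl, e 1, rfl⟩
    · rw [map_sum]
      simp_rw [toHG_pr]
      rw [← hsum, Finsupp.sum]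
      have h2 : ∀ i : Fin n, (2 * cf (a i).val / 2) • (a i).val = cf (en i).val • (en i).val := by
        intro i
        rw [mul_div_cancel_left₀ _ (two_ne_zero' ℂ)]
      simp_rw [h2]
      exact ((Equiv.sum_comp en (fun g : {g // g ∈ cf.support} => cf g.val • g.val)).trans
        (Finset.sum_coe_sort cf.support (fun g => cf g • g))).symm

/-! ## 5. Conservativity -/

/-- **`N19g_core → Nonempty QautBridge`**. -/
theorem nonempty_bridge_of_core (hcore : N19g_core T V c D k l) :
    Nonempty (QautDictionary.QautBridge T V c D k l) :=
  ⟨bridge_of_core T V c D k l hcore⟩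

/-- **CONSERVATIVITY of the `N19g` half of seam S5**: pv02-g2's bridge record is, in logical strength, exactly the
leaf `N19g_core` (→ : `QautDictionary.N19g_core_of_bridge`; ← : the junk instance above). -/
theorem nonempty_qautBridge_iff :
    Nonempty (QautDictionary.QautBridge T V c D k l) ↔ N19g_core T V c D k l :=
  ⟨fun ⟨B⟩ => QautDictionary.N19g_core_of_bridge B, nonempty_bridge_of_core T V c D k l⟩

end Bridge

section Binder

variable {U : Universe} (T : U.ThetaModel)

/-- **Binder-level form** (the exact hypothesis shapes in play): carver-g2's `hQ` binder of
`AssemblyPrint.perL_of_printDictLeaves` / `N19g_genInWedgeSpan_of_bridges` ("a Qaut bridge in every good context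
on the `(34)` side") is EQUIVALENT to the model-level leaf binder `hcore` of `AssemblyLeaves.N19g_genInWedgeSpan_of_core`. -/
theorem qautBridges_iff_core :
    (∀ {L : CMField} {ι₁ : L →+* ℂ} (V : HermSpace3 L ι₁) (c : SeesawCtx L), T.GoodCtx ι₁ c →
      Nonempty (QautDictionary.QautBridge T V c (T.t34 V c) 2 3)) ↔
    (∀ {L : CMField} {ι₁ : L →+* ℂ} (V : HermSpace3 L ι₁) (c : SeesawCtx L), T.GoodCtx ι₁ c →
      N19g_core T V c (T.t34 V c) 2 3) :=
  ⟨fun h _ _ V c hc => (nonempty_qautBridge_iff T V c (T.t34 V c) 2 3).mp (h V c hc),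
    fun h _ _ V c hc => (nonempty_qautBridge_iff T V c (T.t34 V c) 2 3).mpr (h V c hc)⟩

end Binder

end S5ConservativeQaut
end PerL34
end HodgeCM

end
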